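import Summits.BirchSwinnertonDyer.BirchSwinnertonDyer.Theorems.PrintCf2RubinValueTwoTwoVariableMCSemilocalColemanTwoVar
import Literature.NumberTheory.GaloisRepresentations.LubinTateColemanUnitsImageModuleTwo
import HarnessLib

/-!
# Brick (c) at `p = 2`, MODULE FORM: the cokernel of the two-variable Coleman transform is PSEUDO-NULL over `Λ = 𝒪_F⟦X⟧⟦T⟧`,
# its target is free of rank `2d`, its image `N ≅ 𝒰¹_∞` is finitely generated — the `hcoker` input of `charIdeal_quotient_eq_span_of_colemanMap_dvr`

Cell `bsd-print-cf2`, width seat `bsd-line-cf2c-w7` g11, route C `PrintCf2RubinValueTwo`, crux of record stmt-BirchSwinnertonDyer-24033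
`TwoVariableMainConjAtSplitTwoQuad` (23720 nominal), BRICK §4(c) «semi-local structure at `v` over the two-variable tower at `p = 2`».
The seat's g0 file `PrintCf2RubinValueTwoTwoVariableMCSemilocalColemanTwoVar` proved the ring-generic half of de Shalit III.1.10 at
`p = 2`: a `Λ`-module FINITELY GENERATED OVER THE COEFFICIENT DVR is pseudo-null over `𝒪⟦T₂⟧⟦T₁⟧` (`isPseudoNull_dvr_of_moduleFinite`), and
`char(U/C) = (L)` from a Coleman map `i : U → Λ` with pseudo-null kernel and cokernel (`charIdeal_quotient_eq_span_of_colemanMap_dvr`),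
"the local theory itself … the displayed hypothesis `(i, hker, hcoker, hC)`".  Generations g2–g11 BUILT that local theory
(`Literature/NumberTheory/GaloisRepresentations/LubinTateColeman*`), ending in the module packaging
`LubinTateColemanUnitsImageModuleTwo`: `N = unitsImage … ≤ M = (ColemanCoordModule)^{ℤ/d}`, `N =` the transforms of the principal
norm-coherent unit families of the two-variable local tower, `M = N + 𝒪_F·G₀`.  THIS file discharges `hcoker` in that currency:

* `moduleFinite_colemanCoordModulePi`, `moduleFree_…`, ★ `finrank_colemanCoordModulePi = 2·d` — the target `M` over `Λ = 𝒪_F⟦X⟧⟦T⟧`;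
* `moduleFinite_unitsImage` — `N` is finitely generated (`Λ` Noetherian);
* ★★★ **`isPseudoNull_quotient_unitsImage`** — **`M ⧸ N` is PSEUDO-NULL over `Λ`**: it is cyclic over `𝒪_F` (`exists_forall_sub_C_smul_mem_unitsImage`)
  with the compatible structure `a • m = C(C a) • m`, so g0's `isPseudoNull_dvr_of_moduleFinite` applies (`𝒪_F` a DVR).

With `Col : 𝒰¹_∞ ≅ N` (`mem_unitsImage_iff_exists_principal`, `eq_of_colemanTransformProd₂_eq`) this is de Shalit's
`0 → 𝒰 ⊗̂ 𝒪 → Λ(𝒢_a,𝒪) → 𝒪(1) → 0` (I §3.8 (17)) at `q = 2` as `Λ`-modules with pseudo-null cokernel — the (c)-input of LTYZ 2025 Thm. 7.2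
(Yager at `2`) for one prime of the two-variable tower.  THEOREMS ONLY (no `def`, no named fact, no `sorry`); Theses-free; `--supports` the
crux as a helper.  NOT here: the semi-local product over the primes above `𝔭`, the `Λ(𝒢) → ℤ₂⟦T₁,T₂⟧` dictionary of ty2's
`SemilocalUnitData₂`, the elliptic units (`hC`).  BSD is not proved by any of this; no summit statement is proved here.

## References
* [deShalit1987] E. de Shalit, *Iwasawa theory of elliptic curves with complex multiplication* (1987), I Thm. 3.7 (13), §3.8 (17);
  III §1.3, Lemma 1.10 (proof), §1.14.
-/

noncomputable section

set_option linter.dupNamespace false -- `Summit.BirchSwinnertonDyer.BirchSwinnertonDyer` (summit = problem) is the tree's layout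
set_option autoImplicit false

namespace Summit.BirchSwinnertonDyer.BirchSwinnertonDyer.Theorems.PrintCf2.ColemanImage

open Literature.NumberTheory.GaloisRepresentations Literature.NumberTheory.GaloisRepresentations.IsNonarchimedeanLocalField
  Literature.NumberTheory.GaloisRepresentations.LubinTate ValuativeRel Field
open Literature.NumberTheory.EllipticCurves

variable {F : Type} [Field F] [ValuativeRel F] [TopologicalSpace F] [IsNonarchimedeanLocalField F]

attribute [local instance] ltNormUniformSpace ltNormIsUniformAddGroup rk1 nF nE fintypeResidueField

variable {p : ℕ} [hp : Fact p.Prime] {d : ℕ} (hd : d.Coprime p)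
variable {π : 𝒪[F]} (hπ : (valuation F).IsUniformizer (π : F))
variable (E : ℕ → IntermediateField F (AlgebraicClosure F)) [∀ m, FiniteDimensional F (E m)] [∀ m, Normal F (E m)]
  [∀ m, IsGalois F (E m)] (hmono : Monotone E) (hE : ∀ m, E m ≤ maxUnramified F) (hdeg : ∀ m, Module.finrank F (E m) = d * p ^ m)
  {σ₀ : absoluteGaloisGroup F} (hσ₀ : IsAbsArithFrob σ₀) (hq : residueFieldCard F = 2)
variable (u : (LTCoeff F)ˣ) (hu : LTCoeff.of F π = residueFieldCard F * u) (γ w : 𝒪[F]ˣ) (hγ : (γ : 𝒪[F]) = 1 + π ^ 2 * w)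
variable [IsAdicComplete (Ideal.span {intBase F (LTCoeff.of F π)}) (PowerSeries 𝒪[F])] [NeZero d]

/-! ## §1. The target `M = (ColemanCoordModule)^{ℤ/d}` over `Λ = 𝒪_F⟦X⟧⟦T⟧` -/

include hγ in
/-- `M` is a finitely generated `Λ`-module. [cite: deShalit1987, I §3.8 (17)] -/
theorem moduleFinite_colemanCoordModulePi :
    Module.Finite (PowerSeries (PowerSeries 𝒪[F])) (ZMod d → ColemanCoordModule hπ hq (intBase F) u hu γ) :=
  haveI := finite_colemanCoordModule hπ hq (intBase F) u hu γ (eq_zero_of_C_pi_mul_eq_zero_integer hπ) w hγ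
  Module.Finite.pi

include hγ in
/-- `M` is a free `Λ`-module. [cite: deShalit1987, I §3.8 (17)] -/
theorem moduleFree_colemanCoordModulePi :
    Module.Free (PowerSeries (PowerSeries 𝒪[F])) (ZMod d → ColemanCoordModule hπ hq (intBase F) u hu γ) :=
  haveI := free_colemanCoordModule hπ hq (intBase F) u hu γ (eq_zero_of_C_pi_mul_eq_zero_integer hπ) w hγ
  Module.Free.pi _ _

include hγ in
/-- ★ **`rank_Λ M = 2d`** (`Λ = 𝒪_F⟦X⟧⟦T⟧ = Λ(ℤ_p × Γ')`, index `2d = |ℤ/d × Δ|` in the local Galois group). [cite: deShalit1987, I §3.8 (17)] -/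
theorem finrank_colemanCoordModulePi :
    Module.finrank (PowerSeries (PowerSeries 𝒪[F])) (ZMod d → ColemanCoordModule hπ hq (intBase F) u hu γ) = 2 * d := by
  haveI := free_colemanCoordModule hπ hq (intBase F) u hu γ (eq_zero_of_C_pi_mul_eq_zero_integer hπ) w hγ
  haveI := finite_colemanCoordModule hπ hq (intBase F) u hu γ (eq_zero_of_C_pi_mul_eq_zero_integer hπ) w hγ
  rw [Module.finrank_pi_fintype, Finset.sum_const, Finset.card_univ, ZMod.card, smul_eq_mul, mul_comm,
    finrank_colemanCoordModule hπ hq (intBase F) u hu γ (eq_zero_of_C_pi_mul_eq_zero_integer hπ) w hγ]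

/-! ## §2. The image `N` and the cokernel `M/N` -/

variable {θ : ∀ m, unitBall (E m)} (hθ : ∀ m, IsIntegralNormalGen (E m) (θ m))
  (hcoh : ∀ m, unitBallTrace (hmono (Nat.le_succ m)) (θ (m + 1)) = θ m)
variable [CharZero F] [IsAdicComplete (Ideal.span {(p : 𝒪[F])}) 𝒪[F]] (hI : Ideal.span {(p : 𝒪[F])} ≠ ⊤)
  (hud : ∀ m, (u : LTCoeff F) ^ Module.finrank F (E m) ≠ 1)

include hγ in
/-- **`N = unitsImage` is a finitely generated `Λ`-module** (`Λ` Noetherian, `M` finitely generated). [cite: deShalit1987, I §3.8 (17); III §1.3] -/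
theorem moduleFinite_unitsImage :
    Module.Finite (PowerSeries (PowerSeries 𝒪[F])) ↥(unitsImage hd hπ E hmono hE hdeg hσ₀ hq u hu γ hθ hcoh hI hud) := by
  haveI := moduleFinite_colemanCoordModulePi (d := d) hπ hq u hu γ w hγ
  haveI : IsNoetherian (PowerSeries (PowerSeries 𝒪[F])) (ZMod d → ColemanCoordModule hπ hq (intBase F) u hu γ) :=
    isNoetherian_of_isNoetherianRing_of_finite _ _
  exact Module.Finite.of_fg (IsNoetherian.noetherian _)

include hE hdeg hσ₀ hcoh in
/-- ★★★ **The cokernel `M ⧸ N` of the two-variable Coleman transform is PSEUDO-NULL over `Λ = 𝒪_F⟦X⟧⟦T⟧`** (de Shalit's `𝒪(1)` in (17):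
finitely generated — indeed cyclic — over the coefficient DVR `𝒪_F` with `a • m = C(C a) • m`, hence pseudo-null by g0's
`isPseudoNull_dvr_of_moduleFinite`).  This is the hypothesis `hcoker` of `charIdeal_quotient_eq_span_of_colemanMap_dvr` for the local
Coleman map at `p = 2`. [cite: deShalit1987, I Thm. 3.7 (13), §3.8 (17); III Lemma 1.10 (proof), §1.14] -/
theorem isPseudoNull_quotient_unitsImage (hm : ∃ m₁ : ℕ, LTCoeff.of F π ^ 2 ∣ LTCoeff.of F π - m₁) :
    Module.IsPseudoNull (PowerSeries (PowerSeries 𝒪[F]))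
      ((ZMod d → ColemanCoordModule hπ hq (intBase F) u hu γ) ⧸ unitsImage hd hπ E hmono hE hdeg hσ₀ hq u hu γ hθ hcoh hI hud) := by
  set N := unitsImage hd hπ E hmono hE hdeg hσ₀ hq u hu γ hθ hcoh hI hud with hN
  -- the compatible `𝒪_F`-structure on the cokernel
  letI : Module 𝒪[F] ((ZMod d → ColemanCoordModule hπ hq (intBase F) u hu γ) ⧸ N) :=
    Module.compHom _ ((PowerSeries.C (R := PowerSeries 𝒪[F])).comp (PowerSeries.C (R := 𝒪[F])))
  have hcompat : ∀ (a : 𝒪[F]) (q : (ZMod d → ColemanCoordModule hπ hq (intBase F) u hu γ) ⧸ N),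
      a • q = (PowerSeries.C (PowerSeries.C a) : PowerSeries (PowerSeries 𝒪[F])) • q := fun _ _ => rfl
  -- cyclic over `𝒪_F`
  obtain ⟨G₀, hG₀⟩ := exists_forall_sub_C_smul_mem_unitsImage hπ E hmono hE hdeg hσ₀ hq u hu γ hθ hcoh hI hud hm
  haveI : Module.Finite 𝒪[F] ((ZMod d → ColemanCoordModule hπ hq (intBase F) u hu γ) ⧸ N) := by
    refine ⟨⟨{N.mkQ G₀}, ?_⟩⟩
    refine eq_top_iff.mpr fun q _ => ?_
    obtain ⟨G, rfl⟩ := N.mkQ_surjective q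
    obtain ⟨a, ha⟩ := hG₀ G
    have e : N.mkQ G = a • N.mkQ G₀ := by
      rw [hcompat, ← map_smul, ← sub_eq_zero, ← map_sub, Submodule.mkQ_apply, Submodule.Quotient.mk_eq_zero]
      exact ha
    rw [Finset.coe_singleton, e]
    exact Submodule.smul_mem _ _ (Submodule.mem_span_singleton_self _)
  exact SemilocalColeman.isPseudoNull_dvr_of_moduleFinite hcompat

end Summit.BirchSwinnertonDyer.BirchSwinnertonDyer.Theorems.PrintCf2.ColemanImage

end
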